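import Literature.NumberTheory.EllipticCurves.BSDSelmerCMPConverseCMFieldTwistFamily
import Literature.NumberTheory.EllipticCurves.IsogenyRationalCMProofs
import Literature.NumberTheory.EllipticCurves.IsogenyHasCMProofs
import Literature.NumberTheory.EllipticCurves.HeegnerPointsImaginaryQuadraticProofs
import Mathlib.NumberTheory.NumberField.Cyclotomic.Ideal
import HarnessLib

/-!
# Burungale–Tian 2026, Remark 3.6 (i): the `j = 0` curves `y² = x³ + B` over `ℚ(ζ₃)` satisfy the
# hypotheses of Prop. 1.3 / Thm. 3.5 — proofs only

A `…Proofs` companion (theorems only; no definitions, no named facts) of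
`BSDSelmerCMPConverseCMFieldTwistFamily` (A. A. Burungale, Y. Tian, Ann. of Math. 203 (2026),
Prop. 1.3 and Thm. 3.5, typed there as `burungaleTian_prop13_analyticRank_twists`,
`burungaleTian_thm35_selmerCorank_three_twists`). Remark 3.6 (i), p. 7: "For any `n ∈ ℤ ∖ {0}`, the
cube sum elliptic curve `E_n : x³ + y³ = 2n` satisfies the hypotheses of Proposition 1.3, with
`K = ℚ(ζ₃)`." The hypotheses are discharged here in the kernel for every `y² = x³ + B`, `B ≠ 0`, over
any `3`rd cyclotomic field `K` (the cube-sum curves are of this shape: `x³ + y³ = a` is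
`Y² = X³ − 432a²`):

* `K = ℚ(ζ₃)` is imaginary quadratic — tree `isImaginaryQuadratic_of_isCyclotomicExtension_three`;
* `y² = x³ + B` has `K`-rational CM — tree `hasRationalCM_of_isPrimitiveRoot_three` (the automorphism
  `(x, y) ↦ (ζ₃ x, y)` is defined over `K`);
* **`3` is not inert in `ℚ(ζ₃)`** (`not_isPrime_span_three_of_isCyclotomicExtension_three`): it
  ramifies, `(3) = (ζ₃ − 1)²` (Mathlib `IsCyclotomicExtension.Rat.associated_zeta_sub_one_pow_prime`),
  and the square of a nonzero prime of a Dedekind domain is not prime.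

Hence (`burungaleTian_prop13_mk_a₆_of`, `burungaleTian_thm35_mk_a₆_of`): granted the two facts, for
every such `B`, at least `50%` of the quadratic twists `E^{(t)}`, `t ∈ K^×/(K^×)²` (BKLOS height
ordering), have analytic rank `0`, resp. `Sel_{3^∞}`-corank `0`, over `K = ℚ(ζ₃)`.

## References

* [BurungaleTian2026] Ann. of Math. (2) 203 (2026) 1–13 = arXiv:2506.03465v2: Prop. 1.3, Thm. 3.5,
  Rem. 3.6 (i) (p. 7).
* [BhargavaKlagsbrunLemkeOliverShnidman2019] Duke Math. J. 168 (2019): Thm. 2.7, §12 (the cube-sum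
  example).
-/

noncomputable section

open scoped Classical
open NumberField WeierstrassCurve

namespace Literature.NumberTheory.EllipticCurves

/-- **`3` is not inert in `ℚ(ζ₃) = ℚ(√−3)`**: the ideal `3𝓞_K` is not prime, since
`(3) = (ζ₃ − 1)²` with `(ζ₃ − 1)` a nonzero prime (`3` ramifies). Mathlib:
`IsCyclotomicExtension.Rat.associated_zeta_sub_one_pow_prime`, `isPrime_span_zeta_sub_one'`,
`Ideal.pow_right_strictAnti`. This is the clause "`3` is not inert in `K`" of the hypotheses of
Prop. 1.3 that Burungale–Tian, Rem. 3.6 (i), assert for `K = ℚ(ζ₃)`.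
[cite: BurungaleTian2026, Rem. 3.6 (i) (p. 7: the hypotheses of Prop. 1.3 hold with K = ℚ(ζ₃))] -/
theorem not_isPrime_span_three_of_isCyclotomicExtension_three (K : Type*) [Field K] [NumberField K]
    [IsCyclotomicExtension {3} ℚ K] : ¬ (Ideal.span ({3} : Set (𝓞 K))).IsPrime := by
  haveI : Fact (Nat.Prime 3) := ⟨Nat.prime_three⟩
  have hζ := IsCyclotomicExtension.zeta_spec 3 ℚ K
  set P : Ideal (𝓞 K) := Ideal.span {hζ.toInteger - 1} with hPdef
  have hassoc := IsCyclotomicExtension.Rat.associated_zeta_sub_one_pow_prime 3 hζ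
  have hassoc' : Associated ((hζ.toInteger - 1) ^ 2) (3 : 𝓞 K) := by simpa using hassoc
  have h3 : Ideal.span ({3} : Set (𝓞 K)) = P ^ 2 := by
    rw [hPdef, Ideal.span_singleton_pow]
    exact Ideal.span_singleton_eq_span_singleton.mpr hassoc'.symm
  have hP : P.IsPrime := IsCyclotomicExtension.Rat.isPrime_span_zeta_sub_one' 3 hζ
  have hP0 : P ≠ ⊥ := by
    rw [hPdef, ne_eq, Ideal.span_singleton_eq_bot]
    exact hζ.zeta_sub_one_prime'.ne_zero
  have hlt : P ^ 2 < P ^ 1 := Ideal.pow_right_strictAnti P hP0 hP.ne_top (by norm_num : 1 < 2)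
  rw [pow_one] at hlt
  intro hprime
  rw [h3] at hprime
  have hle : P ≤ P ^ 2 := by
    rcases hprime.mul_le.mp (le_of_eq (sq P).symm) with h | h <;> exact h
  exact absurd (lt_of_le_of_lt hle hlt) (lt_irrefl _)

/-- **Burungale–Tian 2026, Remark 3.6 (i), for Prop. 1.3**: granted Prop. 1.3
(`burungaleTian_prop13_analyticRank_twists`), for every `3`rd cyclotomic field `K = ℚ(ζ₃)` (universe
`0`) and every `B ≠ 0`, at least `50%` of the quadratic twists of `y² = x³ + B` over `K` have
analytic rank `0` — the hypotheses "`K` imaginary quadratic", "CM by an order of `K` over `K`",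
"`3` not inert in `K`" being theorems (`isImaginaryQuadratic_of_isCyclotomicExtension_three`,
`hasRationalCM_of_isPrimitiveRoot_three`, `not_isPrime_span_three_of_isCyclotomicExtension_three`).
[cite: BurungaleTian2026, Prop. 1.3 and Rem. 3.6 (i) (p. 7)] -/
theorem burungaleTian_prop13_mk_a₆_of (h : burungaleTian_prop13_analyticRank_twists)
    (K : Type) [Field K] [NumberField K] [IsCyclotomicExtension {3} ℚ K] {B : K} (hB : B ≠ 0) :
    SquareClassProportionGe
      (TwistClassSatisfies (⟨0, 0, 0, 0, B⟩ : WeierstrassCurve K)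
        fun E : WeierstrassCurve K ↦ E.analyticRank = 0) (1 / 2) := by
  have hζ := IsCyclotomicExtension.zeta_spec 3 ℚ K
  haveI : (⟨0, 0, 0, 0, B⟩ : WeierstrassCurve K).IsElliptic :=
    isElliptic_mk_a₆ (by norm_num) (by norm_num) hB
  exact h K isImaginaryQuadratic_of_isCyclotomicExtension_three
    (not_isPrime_span_three_of_isCyclotomicExtension_three K) _
    (hasRationalCM_of_isPrimitiveRoot_three hζ hB)

/-- **Burungale–Tian 2026, Remark 3.6 (i), for Thm. 3.5** (= BKLOS 2019 Thm. 2.7 for these curves):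
granted Thm. 3.5 (`burungaleTian_thm35_selmerCorank_three_twists`), for every `K = ℚ(ζ₃)` and
`B ≠ 0`, at least `50%` of the quadratic twists of `y² = x³ + B` over `K` have `Sel_{3^∞}`-corank `0`.
[cite: BurungaleTian2026, Thm. 3.5 and Rem. 3.6 (i) (p. 7)]
[cite: BhargavaKlagsbrunLemkeOliverShnidman2019, Thm. 2.7] -/
theorem burungaleTian_thm35_mk_a₆_of (h : burungaleTian_thm35_selmerCorank_three_twists)
    (K : Type) [Field K] [NumberField K] [IsCyclotomicExtension {3} ℚ K] {B : K} (hB : B ≠ 0) :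
    SquareClassProportionGe
      (TwistClassSatisfies (⟨0, 0, 0, 0, B⟩ : WeierstrassCurve K)
        fun E : WeierstrassCurve K ↦ E.selmerCorank 3 = 0) (1 / 2) := by
  have hζ := IsCyclotomicExtension.zeta_spec 3 ℚ K
  haveI : (⟨0, 0, 0, 0, B⟩ : WeierstrassCurve K).IsElliptic :=
    isElliptic_mk_a₆ (by norm_num) (by norm_num) hB
  exact h K isImaginaryQuadratic_of_isCyclotomicExtension_three
    (not_isPrime_span_three_of_isCyclotomicExtension_three K) _
    (hasRationalCM_of_isPrimitiveRoot_three hζ hB)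

end Literature.NumberTheory.EllipticCurves

end
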